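import Mathlib
import Summits.ValiantsHypothesis.ValiantsHypothesis.Theorems.KPlusLogSqLawTridiagonalRealStaticGapProductFour

/-!
# Gap products of the pattern `c, c+g, c+2g (occupied midpoint), c+3g, c+4g` (arithmetic core of the RATIO-THREE FACE LAW)

Sequel of `…TridiagonalRealStaticGapProductFour.lean` (this lineage's ENS / face-rule lane on the static symmetric tridiagonal register of
`WeakLifting`, stmt-ValiantsHypothesis-19561).  For an injective integer labelling `z` of a finite set `Act` on the lattice `c + gℤ` containing
members with the values `c, c+g, c+3g, c+4g` (a face with slopes of absolute values `g` and `3g`) AND a member with the MIDPOINT value `c+2g`,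
the gap products `W_P = ∏_{Q ≠ P} |z_P − z_Q|` satisfy `W_{c+g} · W_{c+3g} < W_c · W_{c+4g}` (`gapProduct_one_three_mid`,
`gapProduct_progression_one_three_mid`): the five special points contribute `36` against `576`, i.e. a factor `16`, and every other member sits
at an offset `j ≥ 1` beyond an extreme, contributing `(j+1)(j+3)` against `j(j+4)`; one side telescopes to at most `4(N+1)/(N+4) < 4`
(`prod_Icc_ratio_three`, `prod_ratio_lt_four`), so the middles fall short by a factor `< 16/16`.  Without the occupied midpoint the inequality can
fail (located: survivors exist at every `m ≥ 6`), so the midpoint hypothesis is load-bearing.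

HONEST FRAMING: elementary arithmetic; nothing here is about pencils, `WeakLifting`, Conjecture B, `MatrixDescartes` (18050) or `VP ≠ VNP`.
Seat: prover val-sym-lift-p2 g18, `--supports stmt-ValiantsHypothesis-19561`.
-/

set_option linter.dupNamespace false
set_option autoImplicit false

namespace Summit.ValiantsHypothesis.ValiantsHypothesis.Theorems.KPlusLogSqLaw

namespace EdgeNormalForm

open Finset

/-! ## 1. Arithmetic: the external offsets telescope (ratio three) -/

/-- `∏_{j=1}^{N} (j+1)(j+3)/(j(j+4)) = 4(N+1)/(N+4)`. [folklore] -/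
theorem prod_Icc_ratio_three (N : ℕ) :
    ∏ j ∈ Icc 1 N, (((j : ℝ) + 1) * ((j : ℝ) + 3)) / ((j : ℝ) * ((j : ℝ) + 4)) = 4 * ((N : ℝ) + 1) / ((N : ℝ) + 4) := by
  induction N with
  | zero => norm_num
  | succ N ih =>
    rw [Finset.prod_Icc_succ_top (by omega), ih]
    push_cast
    field_simp
    ring

/-- for a finite set `S` of POSITIVE integers, `∏_{j∈S} (j+1)(j+3) < 4 · ∏_{j∈S} j(j+4)`. [folklore] -/
theorem prod_ratio_lt_four (S : Finset ℕ) (hS : ∀ j ∈ S, 1 ≤ j) :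
    ∏ j ∈ S, (((j : ℝ) + 1) * ((j : ℝ) + 3)) < 4 * ∏ j ∈ S, ((j : ℝ) * ((j : ℝ) + 4)) := by
  have hpos : 0 < ∏ j ∈ S, ((j : ℝ) * ((j : ℝ) + 4)) :=
    Finset.prod_pos fun j hj => mul_pos (by exact_mod_cast hS j hj) (by positivity)
  rcases S.eq_empty_or_nonempty with rfl | hne
  · norm_num
  set N := S.max' hne with hN
  have hsub : S ⊆ Icc 1 N := fun j hj => Finset.mem_Icc.mpr ⟨hS j hj, S.le_max' j hj⟩
  have hR : ∏ j ∈ S, (((j : ℝ) + 1) * ((j : ℝ) + 3)) / ((j : ℝ) * ((j : ℝ) + 4)) ≤ 4 * ((N : ℝ) + 1) / ((N : ℝ) + 4) := by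
    rw [← prod_Icc_ratio_three N]
    have hext : ∏ j ∈ S, (((j : ℝ) + 1) * ((j : ℝ) + 3)) / ((j : ℝ) * ((j : ℝ) + 4)) =
        ∏ j ∈ Icc 1 N, (if j ∈ S then (((j : ℝ) + 1) * ((j : ℝ) + 3)) / ((j : ℝ) * ((j : ℝ) + 4)) else 1) := by
      rw [Finset.prod_ite_mem, Finset.inter_eq_right.mpr hsub]
    rw [hext]
    refine Finset.prod_le_prod (fun j _ => ?_) (fun j hj => ?_)
    · split_ifs <;> positivity
    · have hj1 : (1 : ℝ) ≤ j := by exact_mod_cast (Finset.mem_Icc.mp hj).1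
      split_ifs
      · exact le_rfl
      · rw [le_div_iff₀ (by positivity)]
        nlinarith
  have hsplit : ∏ j ∈ S, (((j : ℝ) + 1) * ((j : ℝ) + 3)) =
      (∏ j ∈ S, (((j : ℝ) + 1) * ((j : ℝ) + 3)) / ((j : ℝ) * ((j : ℝ) + 4))) * ∏ j ∈ S, ((j : ℝ) * ((j : ℝ) + 4)) := by
    rw [← Finset.prod_mul_distrib]
    refine Finset.prod_congr rfl fun j hj => ?_
    have : (j : ℝ) * ((j : ℝ) + 4) ≠ 0 := ne_of_gt (mul_pos (by exact_mod_cast hS j hj) (by positivity))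
    rw [div_mul_cancel₀ _ this]
  have hlt : 4 * ((N : ℝ) + 1) / ((N : ℝ) + 4) < 4 := by
    rw [div_lt_iff₀ (by positivity)]; nlinarith
  rw [hsplit]
  exact (mul_le_mul_of_nonneg_right hR hpos.le).trans_lt (mul_lt_mul_of_pos_right hlt hpos)

/-! ## 2. The abstract gap-product lemma: `0, 1, 3, 4` with the midpoint `2` occupied -/

/-- **Slopes one and three with occupied midpoint beat the face rule.**  For an injective integer labelling `z` of `Act` with members of values
`c, c+1, c+3, c+4` and a member of value `c+2`, `W_{c+1} · W_{c+3} < W_c · W_{c+4}`. [this work] -/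
theorem gapProduct_one_three_mid {ι : Type*} [DecidableEq ι] (Act : Finset ι) (z : ι → ℤ)
    (hinj : ∀ P ∈ Act, ∀ Q ∈ Act, z P = z Q → P = Q) (c : ℤ) {E₁ M₁ P₀ M₂ E₂ : ι}
    (hE₁ : E₁ ∈ Act) (hM₁ : M₁ ∈ Act) (hP₀ : P₀ ∈ Act) (hM₂ : M₂ ∈ Act) (hE₂ : E₂ ∈ Act)
    (zE₁ : z E₁ = c) (zM₁ : z M₁ = c + 1) (zP₀ : z P₀ = c + 2) (zM₂ : z M₂ = c + 3) (zE₂ : z E₂ = c + 4) :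
    (∏ Q ∈ Act.erase M₁, |((z M₁ : ℝ)) - z Q|) * (∏ Q ∈ Act.erase M₂, |((z M₂ : ℝ)) - z Q|) <
      (∏ Q ∈ Act.erase E₁, |((z E₁ : ℝ)) - z Q|) * (∏ Q ∈ Act.erase E₂, |((z E₂ : ℝ)) - z Q|) := by
  -- the five are pairwise distinct
  have hne : E₁ ≠ M₁ ∧ E₁ ≠ P₀ ∧ E₁ ≠ M₂ ∧ E₁ ≠ E₂ ∧ M₁ ≠ P₀ ∧ M₁ ≠ M₂ ∧ M₁ ≠ E₂ ∧ P₀ ≠ M₂ ∧ P₀ ≠ E₂ ∧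
      M₂ ≠ E₂ := by
    refine ⟨?_, ?_, ?_, ?_, ?_, ?_, ?_, ?_, ?_, ?_⟩ <;> intro h <;> have := congrArg z h <;> omega
  obtain ⟨h11, h1p, h12, h1e, hmp, hmm, h1E, hp2, hpE, h2E⟩ := hne
  -- externals
  set Ext : Finset ι := ((((Act.erase E₁).erase M₁).erase P₀).erase M₂).erase E₂ with hExt
  have hExt_mem : ∀ Q, Q ∈ Ext ↔ Q ∈ Act ∧ Q ≠ E₁ ∧ Q ≠ M₁ ∧ Q ≠ P₀ ∧ Q ≠ M₂ ∧ Q ≠ E₂ := by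
    intro Q; simp only [hExt, Finset.mem_erase]; tauto
  have hout : ∀ Q ∈ Ext, z Q < c ∨ c + 4 < z Q := by
    intro Q hQ
    obtain ⟨hQA, hQ1, hQ2, hQ3, hQ4, hQ5⟩ := (hExt_mem Q).mp hQ
    by_contra h
    rw [not_or, not_lt, not_lt] at h
    obtain ⟨h1, h2⟩ := h
    have : z Q = c ∨ z Q = c + 1 ∨ z Q = c + 2 ∨ z Q = c + 3 ∨ z Q = c + 4 := by omega
    rcases this with h | h | h | h | h
    · exact hQ1 (hinj Q hQA E₁ hE₁ (h.trans zE₁.symm))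
    · exact hQ2 (hinj Q hQA M₁ hM₁ (h.trans zM₁.symm))
    · exact hQ3 (hinj Q hQA P₀ hP₀ (h.trans zP₀.symm))
    · exact hQ4 (hinj Q hQA M₂ hM₂ (h.trans zM₂.symm))
    · exact hQ5 (hinj Q hQA E₂ hE₂ (h.trans zE₂.symm))
  -- decompositions `Act.erase P = {the other four} ∪ Ext`
  have hdec : ∀ P ∈ Act, ∀ A B C D : ι, A ∈ Act → B ∈ Act → C ∈ Act → D ∈ Act →
      P ≠ A → P ≠ B → P ≠ C → P ≠ D →
      (∀ Q, Q ∈ Act → Q ≠ P → Q ≠ A → Q ≠ B → Q ≠ C → Q ≠ D → Q ∈ Ext) →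
      (∀ Q, Q ∈ Ext → Q ≠ P) →
      Act.erase P = insert A (insert B (insert C (insert D Ext))) := by
    intro P _ A B C D hA hB hC hD hPA hPB hPC hPD hcover hdisj
    ext Q
    simp only [Finset.mem_erase, Finset.mem_insert]
    constructor
    · rintro ⟨hQP, hQA⟩
      by_cases a1 : Q = A; · exact Or.inl a1
      by_cases a2 : Q = B; · exact Or.inr (Or.inl a2)
      by_cases a3 : Q = C; · exact Or.inr (Or.inr (Or.inl a3))
      by_cases a4 : Q = D; · exact Or.inr (Or.inr (Or.inr (Or.inl a4)))
      exact Or.inr (Or.inr (Or.inr (Or.inr (hcover Q hQA hQP a1 a2 a3 a4))))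
    · rintro (rfl | rfl | rfl | rfl | hQ)
      · exact ⟨fun h => hPA h.symm, hA⟩
      · exact ⟨fun h => hPB h.symm, hB⟩
      · exact ⟨fun h => hPC h.symm, hC⟩
      · exact ⟨fun h => hPD h.symm, hD⟩
      · exact ⟨hdisj Q hQ, ((hExt_mem Q).mp hQ).1⟩
  have cov : ∀ Q, Q ∈ Act → Q ≠ E₁ → Q ≠ M₁ → Q ≠ P₀ → Q ≠ M₂ → Q ≠ E₂ → Q ∈ Ext :=
    fun Q hQ a b cc dd e => (hExt_mem Q).mpr ⟨hQ, a, b, cc, dd, e⟩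
  have nE₁ : ∀ Q, Q ∈ Ext → Q ≠ E₁ := fun Q hQ => ((hExt_mem Q).mp hQ).2.1
  have nM₁ : ∀ Q, Q ∈ Ext → Q ≠ M₁ := fun Q hQ => ((hExt_mem Q).mp hQ).2.2.1
  have nP₀ : ∀ Q, Q ∈ Ext → Q ≠ P₀ := fun Q hQ => ((hExt_mem Q).mp hQ).2.2.2.1
  have nM₂ : ∀ Q, Q ∈ Ext → Q ≠ M₂ := fun Q hQ => ((hExt_mem Q).mp hQ).2.2.2.2.1
  have nE₂ : ∀ Q, Q ∈ Ext → Q ≠ E₂ := fun Q hQ => ((hExt_mem Q).mp hQ).2.2.2.2.2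
  have hdecE₁ : Act.erase E₁ = insert M₁ (insert P₀ (insert M₂ (insert E₂ Ext))) :=
    hdec E₁ hE₁ M₁ P₀ M₂ E₂ hM₁ hP₀ hM₂ hE₂ h11 h1p h12 h1e
      (fun Q hQ a b cc dd e => cov Q hQ a b cc dd e) nE₁
  have hdecM₁ : Act.erase M₁ = insert E₁ (insert P₀ (insert M₂ (insert E₂ Ext))) :=
    hdec M₁ hM₁ E₁ P₀ M₂ E₂ hE₁ hP₀ hM₂ hE₂ (Ne.symm h11) hmp hmm h1E
      (fun Q hQ a b cc dd e => cov Q hQ b a cc dd e) nM₁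
  have hdecM₂ : Act.erase M₂ = insert E₁ (insert M₁ (insert P₀ (insert E₂ Ext))) :=
    hdec M₂ hM₂ E₁ M₁ P₀ E₂ hE₁ hM₁ hP₀ hE₂ (Ne.symm h12) (Ne.symm hmm) (Ne.symm hp2) h2E
      (fun Q hQ a b cc dd e => cov Q hQ b cc dd a e) nM₂
  have hdecE₂ : Act.erase E₂ = insert E₁ (insert M₁ (insert P₀ (insert M₂ Ext))) :=
    hdec E₂ hE₂ E₁ M₁ P₀ M₂ hE₁ hM₁ hP₀ hM₂ (Ne.symm h1e) (Ne.symm h1E) (Ne.symm hpE) (Ne.symm h2E)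
      (fun Q hQ a b cc dd e => cov Q hQ b cc dd e a) nE₂
  have xE₁ : E₁ ∉ Ext := fun h => nE₁ E₁ h rfl
  have xM₁ : M₁ ∉ Ext := fun h => nM₁ M₁ h rfl
  have xP₀ : P₀ ∉ Ext := fun h => nP₀ P₀ h rfl
  have xM₂ : M₂ ∉ Ext := fun h => nM₂ M₂ h rfl
  have xE₂ : E₂ ∉ Ext := fun h => nE₂ E₂ h rfl
  -- expand
  have i1 : M₁ ∉ insert P₀ (insert M₂ (insert E₂ Ext)) := by simp only [Finset.mem_insert, not_or]; exact ⟨hmp, hmm, h1E, xM₁⟩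
  have i2 : P₀ ∉ insert M₂ (insert E₂ Ext) := by simp only [Finset.mem_insert, not_or]; exact ⟨hp2, hpE, xP₀⟩
  have i3 : M₂ ∉ insert E₂ Ext := by simp only [Finset.mem_insert, not_or]; exact ⟨h2E, xM₂⟩
  have i4 : E₁ ∉ insert P₀ (insert M₂ (insert E₂ Ext)) := by simp only [Finset.mem_insert, not_or]; exact ⟨h1p, h12, h1e, xE₁⟩
  have i5 : E₁ ∉ insert M₁ (insert P₀ (insert E₂ Ext)) := by simp only [Finset.mem_insert, not_or]; exact ⟨h11, h1p, h1e, xE₁⟩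
  have i6 : M₁ ∉ insert P₀ (insert E₂ Ext) := by simp only [Finset.mem_insert, not_or]; exact ⟨hmp, h1E, xM₁⟩
  have i7 : P₀ ∉ insert E₂ Ext := by simp only [Finset.mem_insert, not_or]; exact ⟨hpE, xP₀⟩
  have i8 : E₁ ∉ insert M₁ (insert P₀ (insert M₂ Ext)) := by simp only [Finset.mem_insert, not_or]; exact ⟨h11, h1p, h12, xE₁⟩
  have i9 : M₁ ∉ insert P₀ (insert M₂ Ext) := by simp only [Finset.mem_insert, not_or]; exact ⟨hmp, hmm, xM₁⟩
  have i10 : P₀ ∉ insert M₂ Ext := by simp only [Finset.mem_insert, not_or]; exact ⟨hp2, xP₀⟩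
  rw [hdecE₁, hdecM₁, hdecM₂, hdecE₂]
  simp only [Finset.prod_insert i1, Finset.prod_insert i2, Finset.prod_insert i3, Finset.prod_insert xE₂, Finset.prod_insert i4,
    Finset.prod_insert i5, Finset.prod_insert i6, Finset.prod_insert i7, Finset.prod_insert i8, Finset.prod_insert i9,
    Finset.prod_insert i10, Finset.prod_insert xM₂]
  rw [zE₁, zM₁, zP₀, zM₂, zE₂]
  push_cast
  -- offsets
  set joff : ι → ℕ := fun Q => (if z Q < c then c - z Q else z Q - c - 4).toNat with hjoff
  have hj : ∀ Q ∈ Ext, 1 ≤ joff Q ∧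
      ((z Q < c ∧ (z Q : ℝ) = c - joff Q) ∨ (c + 4 < z Q ∧ (z Q : ℝ) = c + 4 + joff Q)) := by
    intro Q hQ
    rcases hout Q hQ with h | h
    · have e : (joff Q : ℤ) = c - z Q := by simp only [hjoff, if_pos h]; omega
      refine ⟨by omega, Or.inl ⟨h, ?_⟩⟩
      have e' : ((joff Q : ℤ) : ℝ) = (c : ℝ) - z Q := by exact_mod_cast e
      push_cast at e'; linarith
    · have hn : ¬ z Q < c := by omega
      have e : (joff Q : ℤ) = z Q - c - 4 := by simp only [hjoff, if_neg hn]; omega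
      refine ⟨by omega, Or.inr ⟨h, ?_⟩⟩
      have e' : ((joff Q : ℤ) : ℝ) = (z Q : ℝ) - c - 4 := by exact_mod_cast e
      push_cast at e'; linarith
  have fE : ∀ Q ∈ Ext, |(c : ℝ) - z Q| * |(c : ℝ) + 4 - z Q| = (joff Q : ℝ) * ((joff Q : ℝ) + 4) := by
    intro Q hQ
    obtain ⟨_, h⟩ := hj Q hQ
    have hj0 : (0 : ℝ) ≤ joff Q := by positivity
    rcases h with ⟨_, e⟩ | ⟨_, e⟩ <;> rw [e]
    · rw [show (c : ℝ) - (c - joff Q) = joff Q by ring, show (c : ℝ) + 4 - (c - joff Q) = joff Q + 4 by ring,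
        abs_of_nonneg hj0, abs_of_nonneg (by linarith)]
    · rw [show (c : ℝ) - (c + 4 + joff Q) = -(joff Q + 4) by ring, show (c : ℝ) + 4 - (c + 4 + joff Q) = -(joff Q) by ring,
        abs_neg, abs_neg, abs_of_nonneg hj0, abs_of_nonneg (by linarith), mul_comm]
  have fM : ∀ Q ∈ Ext, |(c : ℝ) + 1 - z Q| * |(c : ℝ) + 3 - z Q| = ((joff Q : ℝ) + 1) * ((joff Q : ℝ) + 3) := by
    intro Q hQ
    obtain ⟨_, h⟩ := hj Q hQ
    have hj0 : (0 : ℝ) ≤ joff Q := by positivity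
    rcases h with ⟨_, e⟩ | ⟨_, e⟩ <;> rw [e]
    · rw [show (c : ℝ) + 1 - (c - joff Q) = joff Q + 1 by ring, show (c : ℝ) + 3 - (c - joff Q) = joff Q + 3 by ring,
        abs_of_nonneg (by linarith), abs_of_nonneg (by linarith)]
    · rw [show (c : ℝ) + 1 - (c + 4 + joff Q) = -(joff Q + 3) by ring, show (c : ℝ) + 3 - (c + 4 + joff Q) = -(joff Q + 1) by ring,
        abs_neg, abs_neg, abs_of_nonneg (by linarith), abs_of_nonneg (by linarith), mul_comm]
  have hL : (|(c : ℝ) + 1 - c| * (|(c : ℝ) + 1 - (c + 2)| * (|(c : ℝ) + 1 - (c + 3)| * (|(c : ℝ) + 1 - (c + 4)| *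
        ∏ Q ∈ Ext, |(c : ℝ) + 1 - z Q|)))) *
      (|(c : ℝ) + 3 - c| * (|(c : ℝ) + 3 - (c + 1)| * (|(c : ℝ) + 3 - (c + 2)| * (|(c : ℝ) + 3 - (c + 4)| *
        ∏ Q ∈ Ext, |(c : ℝ) + 3 - z Q|)))) =
      36 * ∏ Q ∈ Ext, ((joff Q : ℝ) + 1) * ((joff Q : ℝ) + 3) := by
    rw [← Finset.prod_congr rfl fM, Finset.prod_mul_distrib]
    norm_num; ring
  have hR : (|(c : ℝ) - (c + 1)| * (|(c : ℝ) - (c + 2)| * (|(c : ℝ) - (c + 3)| * (|(c : ℝ) - (c + 4)| *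
        ∏ Q ∈ Ext, |(c : ℝ) - z Q|)))) *
      (|(c : ℝ) + 4 - c| * (|(c : ℝ) + 4 - (c + 1)| * (|(c : ℝ) + 4 - (c + 2)| * (|(c : ℝ) + 4 - (c + 3)| *
        ∏ Q ∈ Ext, |(c : ℝ) + 4 - z Q|)))) =
      576 * ∏ Q ∈ Ext, ((joff Q : ℝ) * ((joff Q : ℝ) + 4)) := by
    rw [← Finset.prod_congr rfl fE, Finset.prod_mul_distrib]
    norm_num; ring
  rw [hL, hR]
  -- split the externals into the two sides
  set ExtL := Ext.filter (fun Q => z Q < c) with hExtL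
  set ExtR := Ext.filter (fun Q => ¬ z Q < c) with hExtR
  have hsplit : ∀ g : ι → ℝ, ∏ Q ∈ Ext, g Q = (∏ Q ∈ ExtL, g Q) * ∏ Q ∈ ExtR, g Q := fun g =>
    (Finset.prod_filter_mul_prod_filter_not Ext (fun Q => z Q < c) g).symm
  have hinjL : Set.InjOn joff ExtL := by
    intro Q hQ Q' hQ' h
    have hQm := Finset.mem_filter.mp (Finset.mem_coe.mp hQ)
    have hQ'm := Finset.mem_filter.mp (Finset.mem_coe.mp hQ')
    have e1 : (joff Q : ℤ) = c - z Q := by simp only [hjoff, if_pos hQm.2]; omega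
    have e2 : (joff Q' : ℤ) = c - z Q' := by simp only [hjoff, if_pos hQ'm.2]; omega
    have hz : (joff Q : ℤ) = (joff Q' : ℤ) := by rw [h]
    exact hinj Q ((hExt_mem Q).mp hQm.1).1 Q' ((hExt_mem Q').mp hQ'm.1).1 (by omega)
  have hinjR : Set.InjOn joff ExtR := by
    intro Q hQ Q' hQ' h
    have hQm := Finset.mem_filter.mp (Finset.mem_coe.mp hQ)
    have hQ'm := Finset.mem_filter.mp (Finset.mem_coe.mp hQ')
    have e1 : (joff Q : ℤ) = z Q - c - 4 := by
      simp only [hjoff, if_neg hQm.2]; have := hout Q hQm.1; omega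
    have e2 : (joff Q' : ℤ) = z Q' - c - 4 := by
      simp only [hjoff, if_neg hQ'm.2]; have := hout Q' hQ'm.1; omega
    have hz : (joff Q : ℤ) = (joff Q' : ℤ) := by rw [h]
    exact hinj Q ((hExt_mem Q).mp hQm.1).1 Q' ((hExt_mem Q').mp hQ'm.1).1 (by omega)
  have hposL : ∀ j ∈ ExtL.image joff, 1 ≤ j := by
    intro j hjm; obtain ⟨Q, hQ, rfl⟩ := Finset.mem_image.mp hjm; exact (hj Q (Finset.mem_filter.mp hQ).1).1
  have hposR : ∀ j ∈ ExtR.image joff, 1 ≤ j := by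
    intro j hjm; obtain ⟨Q, hQ, rfl⟩ := Finset.mem_image.mp hjm; exact (hj Q (Finset.mem_filter.mp hQ).1).1
  have hL' := prod_ratio_lt_four (ExtL.image joff) hposL
  have hR' := prod_ratio_lt_four (ExtR.image joff) hposR
  rw [Finset.prod_image hinjL, Finset.prod_image hinjL] at hL'
  rw [Finset.prod_image hinjR, Finset.prod_image hinjR] at hR'
  rw [hsplit (fun Q => ((joff Q : ℝ) + 1) * ((joff Q : ℝ) + 3)), hsplit (fun Q => (joff Q : ℝ) * ((joff Q : ℝ) + 4))]
  have hpL : 0 < ∏ Q ∈ ExtL, ((joff Q : ℝ) * ((joff Q : ℝ) + 4)) :=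
    Finset.prod_pos fun Q hQ => mul_pos (by exact_mod_cast (hj Q (Finset.mem_filter.mp hQ).1).1) (by positivity)
  have hpR : 0 < ∏ Q ∈ ExtR, ((joff Q : ℝ) * ((joff Q : ℝ) + 4)) :=
    Finset.prod_pos fun Q hQ => mul_pos (by exact_mod_cast (hj Q (Finset.mem_filter.mp hQ).1).1) (by positivity)
  have hnL : 0 ≤ ∏ Q ∈ ExtL, (((joff Q : ℝ) + 1) * ((joff Q : ℝ) + 3)) := Finset.prod_nonneg fun Q _ => by positivity
  nlinarith [mul_lt_mul'' hL' hR' hnL (Finset.prod_nonneg fun Q _ => by positivity)]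

/-- lattice form: labels on `c + gℤ`, face values `c, c+g, c+3g, c+4g`, midpoint `c+2g` occupied. [this work] -/
theorem gapProduct_progression_one_three_mid {ι : Type*} [DecidableEq ι] (Act : Finset ι) (z : ι → ℤ)
    (hinj : ∀ P ∈ Act, ∀ Q ∈ Act, z P = z Q → P = Q) (c g : ℤ) (hg : 0 < g) (hmod : ∀ Q ∈ Act, g ∣ z Q - c)
    {E₁ M₁ P₀ M₂ E₂ : ι} (hE₁ : E₁ ∈ Act) (hM₁ : M₁ ∈ Act) (hP₀ : P₀ ∈ Act) (hM₂ : M₂ ∈ Act) (hE₂ : E₂ ∈ Act)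
    (zE₁ : z E₁ = c) (zM₁ : z M₁ = c + g) (zP₀ : z P₀ = c + 2 * g) (zM₂ : z M₂ = c + 3 * g) (zE₂ : z E₂ = c + 4 * g) :
    (∏ Q ∈ Act.erase M₁, |((z M₁ : ℝ)) - z Q|) * (∏ Q ∈ Act.erase M₂, |((z M₂ : ℝ)) - z Q|) <
      (∏ Q ∈ Act.erase E₁, |((z E₁ : ℝ)) - z Q|) * (∏ Q ∈ Act.erase E₂, |((z E₂ : ℝ)) - z Q|) := by
  set z' : ι → ℤ := fun Q => (z Q - c) / g with hz'
  have hzz' : ∀ Q ∈ Act, z Q = c + g * z' Q := fun Q hQ => by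
    have := Int.ediv_mul_cancel (hmod Q hQ); simp only [hz']; linarith [this]
  have hinj' : ∀ P ∈ Act, ∀ Q ∈ Act, z' P = z' Q → P = Q := fun P hP Q hQ h =>
    hinj P hP Q hQ (by rw [hzz' P hP, hzz' Q hQ, h])
  have hg0 : (g : ℤ) ≠ 0 := ne_of_gt hg
  have v1 : z' E₁ = 0 := by simp only [hz', zE₁, sub_self, Int.zero_ediv]
  have v2 : z' M₁ = 0 + 1 := by simp only [hz', zM₁, add_sub_cancel_left, Int.ediv_self hg0, zero_add]
  have v3 : z' P₀ = 0 + 2 := by simp only [hz', zP₀, add_sub_cancel_left, Int.mul_ediv_cancel _ hg0, zero_add]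
  have v4 : z' M₂ = 0 + 3 := by simp only [hz', zM₂, add_sub_cancel_left, Int.mul_ediv_cancel _ hg0, zero_add]
  have v5 : z' E₂ = 0 + 4 := by simp only [hz', zE₂, add_sub_cancel_left, Int.mul_ediv_cancel _ hg0, zero_add]
  have key := gapProduct_one_three_mid Act z' hinj' 0 hE₁ hM₁ hP₀ hM₂ hE₂ v1 v2 v3 v4 v5
  have hresc : ∀ P ∈ Act, ∏ Q ∈ Act.erase P, |((z P : ℝ)) - z Q| =
      (g : ℝ) ^ (Act.erase P).card * ∏ Q ∈ Act.erase P, |((z' P : ℝ)) - z' Q| := by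
    intro P hP
    rw [Finset.pow_card_mul_prod]
    refine Finset.prod_congr rfl fun Q hQ => ?_
    rw [hzz' P hP, hzz' Q (Finset.mem_of_mem_erase hQ)]
    push_cast
    rw [show ((c : ℝ) + g * (z' P) - (c + g * (z' Q))) = g * ((z' P : ℝ) - z' Q) by ring, abs_mul,
      abs_of_pos (by exact_mod_cast hg : (0 : ℝ) < g)]
  have hcardP : ∀ P ∈ Act, (Act.erase P).card = Act.card - 1 := fun P hP => Finset.card_erase_of_mem hP
  rw [hresc M₁ hM₁, hresc M₂ hM₂, hresc E₁ hE₁, hresc E₂ hE₂, hcardP M₁ hM₁, hcardP M₂ hM₂, hcardP E₁ hE₁, hcardP E₂ hE₂]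
  have hgpos : (0 : ℝ) < (g : ℝ) ^ (Act.card - 1) := pow_pos (by exact_mod_cast hg) _
  nlinarith [mul_pos hgpos hgpos, key]

end EdgeNormalForm

end Summit.ValiantsHypothesis.ValiantsHypothesis.Theorems.KPlusLogSqLaw
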